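/-
Copyright: cell `langlands-arthur-audit` (papers/Langlands/langlands-arthur-audit), unit `pub-arthur-typer-g6`
(LEAN TYPER gen 6, 2026-08-18).  Staged for the tree under `Literature/NumberTheory/Automorphic/Arthur2013/Leaves/`
(LEAN-IN-TREE rule 2026-08-18); imports `Mathlib` (linear algebra only: `LinearMap`, `Submodule`), `Leaves.Packets`
(M3 split, §5–§6: scopes and the regions `L17.*`, `L18.*`) and the [Ar] and [Mok] DAG modules (M1, M10).  Module map: M30.
-/
import Mathlib
import Literature.NumberTheory.Automorphic.Arthur2013.Leaves.Packets
import Literature.NumberTheory.Automorphic.Arthur2013.DependencyDag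
import Literature.NumberTheory.Automorphic.Mok2015.DependencyDag

/-!
# Arthur (2013) audit, typed leaves — §16 the intertwining leaves [A26] / [A27]a WITH OPERATORS: [AGIKMS] Main Theorems 1 and 2 (Thms 1.8.1, 1.9.1), Thm 3.5.1, [Mok] Props 3.5.1 and 3.5.3, as identities of linear maps

§6 (`Packets`) types the leaves L17 = [A26] and L18 = [A27]a only as REGIONS of scopes (`L17.needed ⊆
L17.supplied`, `L18.needed ⊆ L18.supplied`) over the opaque identity family `IopIdentity`; §11 (`Intertwining`,
M24) types the local intertwining relation through TRACES and EIGENVALUES of the self-intertwining operators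
(`LeviData.trOp`, `actsBy`), and the cell records (GAPS G-TY-5-3 (a), (b); DIVERGENCE D-TY-38) that the DAG nodes
`A26`, `A27a`, `AGIKMS_181`, `AGIKMS_191` ([Ar] DAG, M1) and `A12`, `P353` ([Mok] DAG, M10) have no
content-carrying reading, because their statements are identities between OPERATORS — the normalised
intertwining operator `R_P(w, π, ψ) : I_P(π) → I_{P'}(wπ)`, the Whittaker functionals `Ω(π)`, `θ^*`, `θ_A`,
`I_P(π̃_ψ(w ⋊ θ))`, `L(ε)`.  This module types them as `K`-linear maps between `K`-modules (Mathlib), over an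
uninterpreted many-sorted signature `OpData K` (Levi subgroups, Weyl-set elements, representations and
normalising parameters are index types per scope; the spaces `I_P(π)` are modules; §16.2), so that the
hypotheses of each statement — tempered / generic / `wπ ≅ π` / `G = O_{2n}(F), det(w) = -1` / `w ∈ W(θ(M), M)` /
regularity of `R_P(w, π_λ, ψ_λ)` at `λ = 0` ([Ar, Prop 2.3.1], [Mok, Prop 3.3.1], recalled at [AGIKMS]
`note30.tex:L1787–L1794`) — are visible binders, and the scope regions are those of §6 (reused, not restated).
Typed VERBATIM: [AGIKMS] Thm 1.8.1 = `main1` (`L1924–L1952`, both parts, with the `O_{2n}` branch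
`Ω(επ) ∘ L(ε)`), the operator `R̃_P(θ ∘ w, π̃_ψ)` as the DEFINED composite of `L2002–L2011`, Thm 1.9.1 = `main2`
(`L2019–L2028`), Thm 3.5.1 = `untwistedGL` (`L5543–L5553`), [Mok] Prop 3.5.3 (a), (b) (`main.tex:L3206–L3220`)
with `R_P(w, π̃_M) = π̃_M(w) ∘ R_P(w, π_M)` (`L3177–L3180`), [Mok] Prop 3.5.1 (the proposition printed with the
citation \cite{A12}, `L3021`) as READ by [AGIKMS] (`note30.tex:L2020`, `L5541`), and the Book's Thm 2.5.1 (b) / Thm 2.5.3 as READINGS ([AGIKMS]'s statements on the consumed regions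
`L18.needed` / `L17.needed`; the Book is NOT held, acq-04129 — every "[Ar, x.y.z]" is the locator printed by
[AGIKMS] `L1924` / `L2020` "cf." or by [Mok] `L3206`, second-hand).  KERNEL FACTS (§16.1, §16.4, §16.6): the
pure linear algebra of the three normalisation arguments — (i) "this scalar must be equal to one" ([Mok]
`L3223`, [AGIKMS] `L13403–L13405`): an operator preserving a Whittaker functional that does not vanish on an
invariant subspace on which the operator is a scalar acts there by `1` (`acts_by_one_of_functional`); (ii) the
tempered case of `main2` (`L4616–L4643`): the three commutative squares give `Ω(π) ∘ R̃ = Ω(π)`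
(`AGIKMS.omega_rtilde_of_squares`), the middle square BEING `main1` (2) (`AGIKMS.middleSquare_of_main1b`), and
with "is a constant multiple of $\theta_A$" (`L2016`) and `Ω(π) ∘ θ_A = Ω(π)` this forces `R̃ = θ_A`
(`AGIKMS.rtilde_eq_thetaA_of_whittaker`, `AGIKMS.main2_tempered_at`); (iii) the general case (`L4999–L5009`):
a commutative "main diagram" over a SURJECTIVE Langlands quotient map transports `R̃_{P_2} = θ_W` to `R̃_P = θ_A`
(`eq_of_comm_squares`); (iv) [Mok] Prop 3.5.3 (a) on Mok's groups follows from `main1` (1) and the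
normalisation of `π̃_M(w)` (`Mok.P353_of_main1`), (b) from (a) (`Mok.P353b_of_a_at`); (v) under the readings
(§16.6) the supply edges `E_A27a`, `E_A26` ([Ar] DAG) and `E_A12`, `E_P353` ([Mok] DAG) are THEOREMS, and the
Book's 2.5.1 (b) / 2.5.3 with content rest on exactly the PREPRINT leaves `AGIKMS_181` / `AGIKMS_191`.
A dependency the DAGs do not draw becomes visible: `main2` (tempered case) consumes `main1` (2) (`L4641`).
NOT typed (cell DIVERGENCE D-TY-54 … D-TY-62): the unnormalised `J_P(w, π_λ)`, `r_P(w, ψ_λ)`, `λ(w)`, `γ_A`,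
meromorphic continuation in `λ` and [AGIKMS] Prop 1.7.2 (multiplicativity); the construction of `θ_A` through
the standard module (`θ_W`, `L1243–L1262`); irreducibility / Schur conclusions ("is a constant multiple of $\theta_A$",
`L2016`; "the restriction of $R_P(w,\widetilde{\pi}_M)$ to the irreducible subspace $\mathcal{V}$ is a non-zero
scalar", [Mok] `L3223`) enter as named instance HYPOTHESES quoting their sentences; [Mok] 3.5.1 (b) in Mok's own form (`R̃_P(w, π̃_{ψ^M}) =
Ĩ_P(π_{ψ^M}, N)` between `H_P` and `H̃_P`).  [AGIKMS] = `AGIKMS2024`, arXiv:2410.13504v3 `note30.tex` (under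
review: `[claim: AGIKMS2024, under-review]`); [Mok] = `Mok2012`, arXiv:1206.0882v5 `main.tex` (Mem. AMS 2015).
Numbering of [AGIKMS] results = v3 PDF (counter `[subsection]`, `note30.tex:L153`): `main1` = 1.8.1, `main2` =
1.9.1, `multiplicative` = Prop 1.7.2, `tits` = Lemma 3.2.1, `langlands` = Lemma 3.3.1, `diagramGL` = Thm 3.4.2,
`untwistedGL` = Thm 3.5.1, `End` = Lemma 3.1.1, `c3` = Lemma 6.3.1.  No `axiom`, `sorry`, `opaque`.
-/

set_option autoImplicit false

namespace Literature.NumberTheory.Automorphic.Arthur2013.Leaves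

/-! ## §16.1  The linear algebra of Whittaker normalisation (kernel) -/

section LinearAlgebra

variable {K : Type} [Field K] {V₁ V₂ : Type} [AddCommGroup V₁] [Module K V₁] [AddCommGroup V₂] [Module K V₂]

/-- **"this scalar must be equal to one."**  If `T` acts on the subspace `U` by the scalar `c`, preserves the
functional `Ω` (`Ω ∘ T = Ω`) and `Ω` does not vanish on `U`, then `c = 1`.  The argument of [Mok] `main.tex:L3223`,
VERBATIM: "Note that part (b) is an immediate consequence of part (a). Indeed the restriction of
$R_P(w,\widetilde{\pi}_M)$ to the irreducible subspace $\mathcal{V}$ is a non-zero scalar. Since the Whittaker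
functional $\Omega_{\chi,\omega}(\pi_M)$ on $\mathcal{H}_{P,\infty}(\pi_M)$ is supported on $\mathcal{V}_{\infty}$,
it follows from (3.5.28) that this scalar must be equal to one."; the same step is [AGIKMS] App. D
`note30.tex:L13403–L13405` ("must preserve $\pi_\ww$, and hence acts on it by a scalar. We assume that this scalar
is $1$. For classical groups, this follows from Theorem \ref{main1} (1) together with Lemma \ref{c3}.").
[folklore] (linear algebra; proved here) -/
theorem scalar_eq_one_of_functional (Ω : V₁ →ₗ[K] K) (T : V₁ →ₗ[K] V₁) (U : Submodule K V₁) (c : K)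
    (hT : ∀ v ∈ U, T v = c • v) (hΩ : Ω ∘ₗ T = Ω) (hv : ∃ v ∈ U, Ω v ≠ 0) : c = 1 := by
  obtain ⟨v, hvU, hvΩ⟩ := hv
  have h1 : Ω (T v) = Ω v := by
    have h := congrArg (fun f : V₁ →ₗ[K] K => f v) hΩ
    simpa using h
  rw [hT v hvU, map_smul, smul_eq_mul] at h1
  exact mul_right_cancel₀ hvΩ (h1.trans (one_mul _).symm)

/-- Under the hypotheses of `scalar_eq_one_of_functional`, `T` acts trivially on `U` ([Mok] Prop 3.5.3 (b) from
(a); [AGIKMS] App. D's assumption from Thm 1.8.1 (1)). [folklore] (linear algebra; proved here) -/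
theorem acts_by_one_of_functional (Ω : V₁ →ₗ[K] K) (T : V₁ →ₗ[K] V₁) (U : Submodule K V₁) (c : K)
    (hT : ∀ v ∈ U, T v = c • v) (hΩ : Ω ∘ₗ T = Ω) (hv : ∃ v ∈ U, Ω v ≠ 0) : ∀ v ∈ U, T v = v := by
  intro v hvU
  rw [hT v hvU, scalar_eq_one_of_functional Ω T U c hT hΩ hv, one_smul]

/-- **The tempered case of [AGIKMS] Thm 1.9.1, last step** (`note30.tex:L4616–L4619`, VERBATIM: "In Section
\ref{sec.main2}, we already argued that $\tl{R}_P(\theta \circ w, \tl{\pi})$ is a constant multiple of $\theta_A$,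
so the equation $\tl{R}_P(\theta \circ w, \tl{\pi}) = \theta_A$ would follow from $\Omega(\pi) \circ
\tl{R}_P(\theta \circ w, \tl{\pi}) = \Omega(\pi)$."): if `T = c • S`, both preserve the NONZERO functional `Ω`
and `S` is surjective, then `T = S`. [folklore] (linear algebra; proved here) -/
theorem eq_of_smul_of_functional (Ω : V₁ →ₗ[K] K) (S T : V₁ →ₗ[K] V₁) (c : K) (hc : T = c • S)
    (hΩT : Ω ∘ₗ T = Ω) (hΩS : Ω ∘ₗ S = Ω) (hΩ : Ω ≠ 0) (hS : Function.Surjective S) : T = S := by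
  have hex : ∃ v, Ω v ≠ 0 := by
    by_contra h
    exact hΩ (LinearMap.ext fun x => by have hx := not_exists.mp h x; simpa using hx)
  obtain ⟨v, hv⟩ := hex
  obtain ⟨u, rfl⟩ := hS v
  have h1 : Ω (T u) = Ω u := by
    have h := congrArg (fun f : V₁ →ₗ[K] K => f u) hΩT
    simpa using h
  have h2 : Ω (S u) = Ω u := by
    have h := congrArg (fun f : V₁ →ₗ[K] K => f u) hΩS
    simpa using h
  rw [hc, LinearMap.smul_apply, map_smul, smul_eq_mul, h2] at h1
  have hu : Ω u ≠ 0 := fun h0 => hv (h2.trans h0)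
  have hc1 : c = 1 := mul_right_cancel₀ hu (h1.trans (one_mul _).symm)
  rw [hc, hc1, one_smul]

/-- **The general case of [AGIKMS] Thm 1.9.1, last step** (`note30.tex:L4999–L5009`, VERBATIM: "Recall that
$\II_\psi^G = I_{P_2}(\tau_2)$ is the standard module of $I_P(\pi_\psi)$. Moreover, by Theorem \ref{main2} for
the tempered case together with analytic continuation, we have \[ \tl{R}_{P_2}(\theta \circ w', \tl\tau_2) =
\theta_W. \] By the definition of $\theta_A$ (see Section \ref{sec.thetaA}), Theorem \ref{diagramGL} together with
Lemma \ref{langlands} implies that \[ \tl{R}_P(\theta \circ w, \tl\pi_\psi) = \theta_A. \]"): a commutative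
square `Λ ∘ Rtop = Rbot ∘ Λ` (Thm 3.4.2, the "main diagram") over a SURJECTIVE `Λ` (Lemma 3.3.1 =
`\label{langlands}`, `L4864`; `L4871–L4873`: the composite `R_{P_1}(w_1, τ_1) ∘ R_{P_2}(w_2, τ_2)` "realizes the
Langlands quotient map. Namely, $I_{P_2}(\tau_2)$ is the standard module of $I_P(\pi_\psi)$, and the above
composition is surjective."), with `Rtop = θ_W` and `Λ ∘ θ_W = θ_A ∘ Λ` (the definition of `θ_A`, `L1243–L1262`),
forces `Rbot = θ_A`.
[folklore] (linear algebra; proved here) -/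
theorem eq_of_comm_squares (Λ : V₂ →ₗ[K] V₁) (hΛ : Function.Surjective Λ) (Rtop θW : V₂ →ₗ[K] V₂)
    (Rbot θA : V₁ →ₗ[K] V₁) (hdiag : Λ ∘ₗ Rtop = Rbot ∘ₗ Λ) (htop : Rtop = θW)
    (hθ : Λ ∘ₗ θW = θA ∘ₗ Λ) : Rbot = θA := by
  rw [htop, hθ] at hdiag
  exact ((LinearMap.cancel_right hΛ).mp hdiag).symm

end LinearAlgebra

/-! ## §16.2  The operator signature -/

/-- **Uninterpreted signature for the intertwining identities of [AGIKMS] §§1.7–1.9 and [Mok] §3.5.**  Per scope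
`s` (the group `G` at a place): `Levi s` = semi-standard Levi components `M` of standard parabolics `P = MN`
(`note30.tex:L1170`, `L1676`); `W s` = elements `w` of the Weyl sets `W(M°, M'°)` (`L1642–L1656`) with their source
and target Levi; `Rep s` = pairs `(M, π)`, `π` an irreducible representation of `M` (or an unramified twist
`π_λ`); `wact w π = wπ`, VERBATIM (`L1679–L1680`): "we define a representation $w \pi_\lambda$ of $M'$ by $w
\pi_\lambda(m') = \pi_\lambda(\tl{w}^{-1} m' \tl{w})$ realized on the space of $\pi$."; `NPar s` = the
parameters `ψ ∈ Ψ(M)` used to normalise; `V π` = the space of `I_P(π)`, a `K`-module (`K = ℂ` in the sources);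
`Omega π = Ω(π)`, the Whittaker functional on `I_P(π)` induced by the FIXED `ω` (`L1905–L1911`; `Ω(wπ)`,
`Ω(επ)`, `Ω(π ∘ θ)` "are induced by the same linear functional $\omega$", `L4640`); `Regular w π ψ` = "$R_P(w,
\pi_\lambda, \psi_\lambda)$ is regular at $\lambda=0$" and `R w π ψ _ = R_P(w, π, ψ)`, VERBATIM (`L1787–L1794`):
"Recall that $R_P(w, \pi_\lambda, \psi_\lambda)$ is regular at $\lambda=0$ (\cite[Proposition 2.3.1]{Ar},
\cite[Proposition 3.3.1]{Mok}), and hence we have a well-defined operator \[ R_P(w, \pi, \psi) \colon I_P(\pi)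
\rightarrow I_{P'}(w\pi). \] When $\pi$ is tempered, taking its $L$-parameter $\phi$, we set $R_P(w, \pi_\lambda)
= R_P(w, \pi_\lambda, \phi_\lambda)$." (`phiOf π = φ`); `detNeg w` = "$G = \O_{2n}(F)$ and $\det(w) = -1$"
(`L1664`); `epsRep π = επ`, `Leps π = L(ε)` (`L1935–L1943`); for `G = GL_N(E)`: `thetaL M = θ(M)`,
`thetaRep π = π ∘ θ`, `thetaPar ψ` = the parameter of `π_ψ ∘ θ`, `thetaStar π = θ^*` (`L1968–L1970`), `IPtw w π
_ = I_P(\tl\pi_\psi(w \rtimes \theta))` (`L1993–L1999`), `IPun w π _ = I_P(\tl\pi_\psi(w))` (`L5551–L5553`; [Mok]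
`π̃_M(w)`, `main.tex:L3172–L3175`), `thetaA π = θ_A` on `I_P(π_ψ)` (`L1986–L1989`); `assoc π ψ` = (`π = π_ψ`, resp.
`π ∈ Π_ψ`); `csd ψ` = the composite `ι ∘ ψ` is conjugate-self-dual (`L1978–L1982`); `Iso` = `≅`; `genSub π` =
[Mok]'s "unique irreducible $(B,\chi)$-generic subrepresentation of $\mathcal{I}_P(\pi_M)$" (`L3217`).  No laws:
every structural identification a statement needs is an explicit hypothesis of that statement (cell
DIVERGENCE D-TY-54 … D-TY-59). [claim: AGIKMS2024, under-review] (notation of §§1.7–1.9, l.1641-2016; signature only) -/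
structure OpData (K : Type) [Field K] where
  /-- semi-standard Levi components `M` of standard parabolic subgroups `P = MN` of `G` -/
  Levi : LocalClassicalScope → Type
  /-- `θ(M)` (`G = GL_N(E)`) -/
  thetaL : {s : LocalClassicalScope} → Levi s → Levi s
  /-- elements of the Weyl sets `W(M°, M'°)` -/
  W : LocalClassicalScope → Type
  /-- `M` with `w ∈ W(M°, M'°)` -/
  src : {s : LocalClassicalScope} → W s → Levi s
  /-- `M'` with `w ∈ W(M°, M'°)` -/
  tgt : {s : LocalClassicalScope} → W s → Levi s
  /-- `G = O_{2n}(F)` and `det(w) = -1` -/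
  detNeg : {s : LocalClassicalScope} → W s → Bool
  /-- pairs `(M, π)`: irreducible representations of Levi subgroups -/
  Rep : LocalClassicalScope → Type
  /-- the Levi subgroup of which `π` is a representation -/
  leviOf : {s : LocalClassicalScope} → Rep s → Levi s
  /-- `wπ`, realized on the space of `π` -/
  wact : {s : LocalClassicalScope} → W s → Rep s → Rep s
  /-- `≅` -/
  Iso : {s : LocalClassicalScope} → Rep s → Rep s → Prop
  /-- `π` tempered -/
  tempered : {s : LocalClassicalScope} → Rep s → Prop
  /-- `π` admits a non-trivial `𝔴_M`-Whittaker functional -/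
  generic : {s : LocalClassicalScope} → Rep s → Prop
  /-- `επ` (`G = O_{2n}(F)`) -/
  epsRep : {s : LocalClassicalScope} → Rep s → Rep s
  /-- `π ∘ θ`, a representation of `θ(M)` (`G = GL_N(E)`) -/
  thetaRep : {s : LocalClassicalScope} → Rep s → Rep s
  /-- normalising parameters `ψ ∈ Ψ(M)` -/
  NPar : LocalClassicalScope → Type
  /-- the `L`-parameter `φ` of a tempered `π` -/
  phiOf : {s : LocalClassicalScope} → Rep s → NPar s
  /-- `π = π_ψ` (resp. `π ∈ Π_ψ`) -/
  assoc : {s : LocalClassicalScope} → Rep s → NPar s → Prop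
  /-- `ι ∘ ψ : L_E × SL_2(ℂ) → M̂ ↪ Ĝ` is conjugate-self-dual -/
  csd : {s : LocalClassicalScope} → NPar s → Prop
  /-- the parameter of `π_ψ ∘ θ` -/
  thetaPar : {s : LocalClassicalScope} → NPar s → NPar s
  /-- `R_P(w, π_λ, ψ_λ)` is regular at `λ = 0` -/
  Regular : {s : LocalClassicalScope} → W s → Rep s → NPar s → Prop
  /-- the space of `I_P(π)` -/
  V : {s : LocalClassicalScope} → Rep s → Type
  [acg : ∀ {s : LocalClassicalScope} (π : Rep s), AddCommGroup (V π)]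
  [mdl : ∀ {s : LocalClassicalScope} (π : Rep s), Module K (V π)]
  /-- the generic irreducible subrepresentation of `I_P(π)` -/
  genSub : {s : LocalClassicalScope} → (π : Rep s) → Submodule K (V π)
  /-- `Ω(π)`, the Whittaker functional on `I_P(π)` induced by the fixed `ω` -/
  Omega : {s : LocalClassicalScope} → (π : Rep s) → (V π →ₗ[K] K)
  /-- `R_P(w, π, ψ) : I_P(π) → I_{P'}(wπ)`, the value at `λ = 0` -/
  R : {s : LocalClassicalScope} → (w : W s) → (π : Rep s) → (ψ : NPar s) → Regular w π ψ →
    (V π →ₗ[K] V (wact w π))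
  /-- `L(ε) : I_P(π) → I_{εPε⁻¹}(επ)`, `(L(ε)f)(g) = f(ε⁻¹g)` -/
  Leps : {s : LocalClassicalScope} → (π : Rep s) → (V π →ₗ[K] V (epsRep π))
  /-- `θ^* : I_P(π) → I_{θ(P)}(π ∘ θ)`, `θ^*(f)(g) = f(θ(g))` -/
  thetaStar : {s : LocalClassicalScope} → (π : Rep s) → (V π →ₗ[K] V (thetaRep π))
  /-- `I_P(π̃(w)) : I_P(wπ) → I_P(π)` induced by the Whittaker-normalised `π̃(w) : wπ ≅ π` -/
  IPun : {s : LocalClassicalScope} → (w : W s) → (π : Rep s) → Iso (wact w π) π → (V (wact w π) →ₗ[K] V π)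
  /-- `I_P(π̃_ψ(w ⋊ θ)) : I_P(w(π_ψ ∘ θ)) → I_P(π_ψ)` induced by the normalised `π̃_ψ(w ⋊ θ)` -/
  IPtw : {s : LocalClassicalScope} → (w : W s) → (π : Rep s) → Iso (wact w (thetaRep π)) π →
    (V (wact w (thetaRep π)) →ₗ[K] V π)
  /-- Arthur's `θ_A : I_P(π_ψ) → I_P(π_ψ)` -/
  thetaA : {s : LocalClassicalScope} → (π : Rep s) → (V π →ₗ[K] V π)

/-- The space of `I_P(π)` is an additive commutative group (field `acg`). [folklore] (signature instance) -/
instance OpData.instAddCommGroupV {K : Type} [Field K] (O : OpData K) {s : LocalClassicalScope} (π : O.Rep s) :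
    AddCommGroup (O.V π) := O.acg π

/-- The space of `I_P(π)` is a `K`-module (field `mdl`). [folklore] (signature instance) -/
instance OpData.instModuleV {K : Type} [Field K] (O : OpData K) {s : LocalClassicalScope} (π : O.Rep s) :
    Module K (O.V π) := O.mdl π

/-! ## §16.3  The statements -/

section Statements

variable {K : Type} [Field K]

/-- `G` is (a restriction of scalars of) a general linear group: `GL_N/F` or `G_{E/F}(N) = Res_{E/F} GL_N`.
[folklore] (tag reading) -/
abbrev isGLScope (s : LocalClassicalScope) : Prop := ∃ N quad, s.type = ClassicalType.GL N quad

/-- **[AGIKMS] Thm 1.8.1 (1) at scope `s`** (`note30.tex:L1924–L1944`), VERBATIM: "Let $\pi$ be an irreducible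
$\ww_M$-generic tempered representation of $M$. \begin{enumerate} \item If $w \in W(M^\circ)$ satisfies that
$w\pi \cong \pi$, then \[ \Omega(w\pi) \circ R_P(w, \pi) = \left\{ \begin{aligned} &\Omega(\epsilon\pi) \circ
L(\epsilon) \iif G = \O_{2n}(F), \, \det(w) = -1, \\ &\Omega(\pi) \other. \end{aligned} \right. \] Here \[
L(\epsilon) \colon I_P(\pi) \rightarrow I_{\epsilon P \epsilon^{-1}}(\epsilon \pi),\, (L(\epsilon)f)(g) =
f(\epsilon^{-1}g). \]".  `w ∈ W(M°)`: `leviOf π = src w = tgt w`; `R_P(w, π) = R_P(w, π, φ)` at the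
`L`-parameter `φ = phiOf π` (`L1793–L1794`). [claim: AGIKMS2024, under-review] (Thm 1.8.1 (1) = main1 (1), l.1924-1944) -/
def AGIKMS.Main1aAt (O : OpData K) (s : LocalClassicalScope) : Prop :=
  ∀ (w : O.W s) (π : O.Rep s), O.leviOf π = O.src w → O.tgt w = O.src w →
    O.tempered π → O.generic π → O.Iso (O.wact w π) π →
    ∀ (hreg : O.Regular w π (O.phiOf π)),
      O.Omega (O.wact w π) ∘ₗ O.R w π (O.phiOf π) hreg =
        (if O.detNeg w then O.Omega (O.epsRep π) ∘ₗ O.Leps π else O.Omega π)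

/-- **[AGIKMS] Thm 1.8.1 (2) at scope `s`** (`note30.tex:L1946–L1952`), VERBATIM: "\item Suppose that $G =
\GL_N(E)$. If $w \in W(M, \theta(M))$ satisfies that $w\pi \cong \pi \circ \theta$, then \[ \Omega(w\pi) \circ
R_P(w, \pi) = \Omega(\pi). \]".  `w ∈ W(M, θ(M))`: `leviOf π = src w`, `tgt w = thetaL (src w)`.
[claim: AGIKMS2024, under-review] (Thm 1.8.1 (2) = main1 (2), l.1946-1952) -/
def AGIKMS.Main1bAt (O : OpData K) (s : LocalClassicalScope) : Prop :=
  ∀ (w : O.W s) (π : O.Rep s), O.leviOf π = O.src w → O.tgt w = O.thetaL (O.src w) →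
    O.tempered π → O.generic π → O.Iso (O.wact w π) (O.thetaRep π) →
    ∀ (hreg : O.Regular w π (O.phiOf π)),
      O.Omega (O.wact w π) ∘ₗ O.R w π (O.phiOf π) hreg = O.Omega π

/-- **[AGIKMS] Thm 1.8.1 at scope `s`**: part (1), and part (2) where `G = GL_N(E)`; (`L1956`) "This theorem is
regarded as the \emph{local intertwining relation} for generic tempered representations."
[claim: AGIKMS2024, under-review] (Thm 1.8.1 = main1, l.1924-1956) -/
def AGIKMS.Main1At (O : OpData K) (s : LocalClassicalScope) : Prop :=
  AGIKMS.Main1aAt O s ∧ (isGLScope s → AGIKMS.Main1bAt O s)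

/-- **[AGIKMS] Thm 1.8.1 = `main1`** on its region `L18.supplied` (§6: `F` of characteristic zero, ALL places;
`G` quasi-split of the five families of `L1899–L1900` "We set $G$ to be $\GL_N(E)$ or a (possibly disconnected)
quasi-split classical group as in the previous subsection."; tempered generic `π`).  STATUS: PREPRINT
arXiv:2410.13504v3, "which was supposed to be proven in \cite{A27}" (`L1923`).
[claim: AGIKMS2024, under-review] (Thm 1.8.1 = main1, l.1899-1956) -/
def AGIKMS.Main1 (O : OpData K) : Prop := ∀ s, L18.supplied s → AGIKMS.Main1At O s

/-- **The Book's Thm 2.5.1 (b), READ** as [AGIKMS]'s Thm 1.8.1 on the consumed region `L18.needed` of §6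
(second-hand: `note30.tex:L1924` "cf. {\cite[Theorem 2.5.1 (b)]{Ar}, \cite[Proposition 3.5.3 (a)]{Mok}}"; the
Book's own wording is not held by the cell).
[cite: Arthur2013, Thm 2.5.1(b) (reading = AGIKMS2024 Thm 1.8.1 restricted to L18.needed; second-hand locator AGIKMS2024 l.1924)] -/
def Book.T251b (O : OpData K) : Prop := ∀ s, L18.needed s → AGIKMS.Main1At O s

/-- **`R̃_P(θ ∘ w, π̃_ψ)`, DEFINED** as in [AGIKMS] `note30.tex:L2002–L2011`, VERBATIM: "Then we can define a
self-intertwining operator \[ \tl{R}_P(\theta \circ w, \tl{\pi}_\psi) \colon I_P(\pi_\psi) \rightarrow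
I_P(\pi_\psi) \] by the composition \[ I_P(\pi_\psi) \xrightarrow{\theta^*} I_{\theta(P)}(\pi_\psi \circ \theta)
\xrightarrow{R_{\theta(P)}(w, \pi_\psi \circ \theta, \psi)} I_{P}(w(\pi_\psi \circ \theta)) \xrightarrow{I_P(\tl\pi_\psi(w
\rtimes \theta))} I_P(\pi_\psi). \]"  Here `ψθ` is the parameter normalising `R_{θ(P)}(w, π_ψ ∘ θ, ·)` (`thetaPar ψ`
in Thm 1.9.1; `phiOf (π ∘ θ)` in the tempered case).
[claim: AGIKMS2024, under-review] (definition of R-tilde, l.2002-2011) -/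
def AGIKMS.RtildeOp (O : OpData K) {s : LocalClassicalScope} (w : O.W s) (π : O.Rep s) (ψθ : O.NPar s)
    (hiso : O.Iso (O.wact w (O.thetaRep π)) π) (hreg : O.Regular w (O.thetaRep π) ψθ) :
    O.V π →ₗ[K] O.V π :=
  O.IPtw w π hiso ∘ₗ O.R w (O.thetaRep π) ψθ hreg ∘ₗ O.thetaStar π

/-- **[AGIKMS] Thm 1.9.1 at scope `s`** (`note30.tex:L2019–L2028`), VERBATIM: "The second main theorem, which
was supposed to be proven in \cite{A26}, is now stated as follows. \begin{thm}[cf. {\cite[Theorem 2.5.3]{Ar},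
\cite[Proposition 3.5.1 (b)]{Mok}}]\label{main2} Let $P=MN$ be a standard parabolic subgroup of $G=\GL_N(E)$, and
let $\psi$ be an $A$-parameter for $M$. Then for any $w \in W(\theta(M),M)$ with $w(\pi_\psi \circ \theta) \cong
\pi_\psi$, we have \[ \tl{R}_P(\theta \circ w, \tl{\pi}_\psi) = \theta_A. \] \end{thm}"; standing assumption
(`L1978–L1982`): "Suppose that the composition \[ L_E \times \SL_2(\C) \xrightarrow{\psi} \widehat{M}
\hookrightarrow \widehat{G} \] is conjugate-self-dual." (`csd ψ`); `π = π_ψ` (`assoc π ψ`); `w ∈ W(θ(M), M)`: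
`src w = thetaL (leviOf π)`, `tgt w = leviOf π`. [claim: AGIKMS2024, under-review] (Thm 1.9.1 = main2, l.1978-2028) -/
def AGIKMS.Main2At (O : OpData K) (s : LocalClassicalScope) : Prop :=
  ∀ (w : O.W s) (π : O.Rep s) (ψ : O.NPar s), O.src w = O.thetaL (O.leviOf π) → O.tgt w = O.leviOf π →
    O.assoc π ψ → O.csd ψ →
    ∀ (hiso : O.Iso (O.wact w (O.thetaRep π)) π) (hreg : O.Regular w (O.thetaRep π) (O.thetaPar ψ)),
      AGIKMS.RtildeOp O w π (O.thetaPar ψ) hiso hreg = O.thetaA π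

/-- **[AGIKMS] Thm 1.9.1 = `main2`** on its region `L17.supplied` (§6: `G = GL_N(E)`, `F ⊆ E` of characteristic
zero, all places; every `A`-parameter of `M`); (`L2029`) "We can say that this theorem is the \emph{twisted local
intertwining relation} for $\GL_N(E)$."  STATUS: PREPRINT.
[claim: AGIKMS2024, under-review] (Thm 1.9.1 = main2, l.2019-2030) -/
def AGIKMS.Main2 (O : OpData K) : Prop := ∀ s, L17.supplied s → AGIKMS.Main2At O s

/-- **The Book's Thm 2.5.3, READ** as [AGIKMS]'s Thm 1.9.1 on the consumed region `L17.needed` of §6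
(second-hand: `note30.tex:L2020` "cf. {\cite[Theorem 2.5.3]{Ar}, \cite[Proposition 3.5.1 (b)]{Mok}}"; `L2030`
"See also \cite[Corollary 2.5.4]{Ar} for Arthur's form of local intertwining relation for twisted $\GL_N(E)$.").
[cite: Arthur2013, Thm 2.5.3 (reading = AGIKMS2024 Thm 1.9.1 restricted to L17.needed; second-hand locator AGIKMS2024 l.2020)] -/
def Book.T253 (O : OpData K) : Prop := ∀ s, L17.needed s → AGIKMS.Main2At O s

/-- **[AGIKMS] Thm 3.5.1 = `untwistedGL` at scope `s`** (`note30.tex:L5543–L5553`), VERBATIM: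
"\begin{thm}\label{untwistedGL} Let $P = MN_P$ be a standard parabolic subgroup of $G = \GL_N(E)$, and let
$\psi$ be an $A$-parameter for $M$. Then for any $w \in W(M)$ with $w\pi_\psi \cong \pi_\psi$, we have \[
I_P(\tl\pi_\psi(w)) \circ R_P(w, \pi_\psi, \psi) = \id, \] where $\tl\pi_\psi(w) \colon w\pi_\psi \rightarrow
\pi_\psi$ is the isomorphism normalized by using a Whittaker functional on the standard module $\II_\psi^M$ of
$\pi_\psi$. \end{thm}"; (`L5540–L5541`) "We state the analogue of Theorem \ref{main2} as in \cite[Proposition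
3.5.1 (a)]{Mok}."; (`L5555–L5556`) "When $G$ is a unitary group $\U_N$, this theorem is needed as a local input
at split places for the global argument." [claim: AGIKMS2024, under-review] (Thm 3.5.1 = untwistedGL, l.5541-5556) -/
def AGIKMS.UntwistedGLAt (O : OpData K) (s : LocalClassicalScope) : Prop :=
  ∀ (w : O.W s) (π : O.Rep s) (ψ : O.NPar s), O.leviOf π = O.src w → O.tgt w = O.src w → O.assoc π ψ →
    ∀ (hiso : O.Iso (O.wact w π) π) (hreg : O.Regular w π ψ),
      O.IPun w π hiso ∘ₗ O.R w π ψ hreg = LinearMap.id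

/-- **[AGIKMS] Thm 3.5.1 = `untwistedGL`** on `L17.supplied` (all `GL` scopes of characteristic zero). STATUS:
PREPRINT. [claim: AGIKMS2024, under-review] (Thm 3.5.1 = untwistedGL, l.5543-5553) -/
def AGIKMS.UntwistedGL (O : OpData K) : Prop := ∀ s, L17.supplied s → AGIKMS.UntwistedGLAt O s

/-- **[Mok]'s canonical self-intertwining operator `R_P(w, π̃_M)`** (`main.tex:L3172–L3180`), VERBATIM: "In
addition, when $w \in W(\pi_M)$, there is a {\it canonical} choice of intertwining operator $\widetilde{\pi}_M(w)
: w \pi_M \rightarrow \pi_M$. More precisely, let $\omega$ be a Whittaker functional for $\pi_M$ with respect to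
the Whittaker datum $(B_M,\chi_M)$. Then $\widetilde{\pi}_M$ is uniquely determined by the condition \[ \omega
\circ \widetilde{\pi}_M = \omega. \] We can then define the canonical self-intertwining operator
\begin{eqnarray} & & R_P(w,\widetilde{\pi}_M) : \mathcal{I}_P(\pi_M) \rightarrow \mathcal{I}_P(\pi_M) \\ & &
R_P(w,\widetilde{\pi}_M) = \widetilde{\pi}_M(w) \circ R_P(w,\pi_M). \nonumber \end{eqnarray}" — with `R_P(w,
π_M)` normalised at the `L`-parameter of the tempered `π_M` (`L3162` "since $\pi_M$ is tempered, the
$L$-parameter of $M$ classifying of $\pi_M$ is determined by $\pi_M$, and so can be omitted from the notation").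
[cite: Mok2012, §3.5 l.3172-3180 (canonical self-intertwining operator)] -/
def Mok.RPtildeOp (O : OpData K) {s : LocalClassicalScope} (w : O.W s) (π : O.Rep s)
    (hiso : O.Iso (O.wact w π) π) (hreg : O.Regular w π (O.phiOf π)) : O.V π →ₗ[K] O.V π :=
  O.IPun w π hiso ∘ₗ O.R w π (O.phiOf π) hreg

/-- **[Mok] Prop 3.5.3 (a) at scope `s`** (`main.tex:L3206–L3213`), VERBATIM: "We then have the following result
from the works of Shahidi \cite{S,S1,S2}: \begin{proposition} ({\it c.f.} statement of Theorem 2.5.1 and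
Corollary 2.5.2 of \cite{A1}) \noindent (a) For $w \in W(\pi_M)$ we have \begin{eqnarray}
\Omega_{\chi,\omega}(\pi_M) \circ R_P(w,\widetilde{\pi}_M) = \Omega_{\chi,\omega}(\pi_M). \end{eqnarray}";
setting (`L3156`): "For this discussion $G$ is a general connected quasi-split group over $F$. For our
purpose we only need to apply the results in the case where $G=U_{E/F}(N)$ or $G_{E/F}(N)$." and (`L3158`) "the
particular case where $\pi_M$ is an irreducible tempered representation of $M(F)$ that is {\it generic}".  `G`
CONNECTED: `detNeg w = false`. [cite: Mok2012, Prop 3.5.3(a) l.3206-3213] -/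
def Mok.P353aAt (O : OpData K) (s : LocalClassicalScope) : Prop :=
  ∀ (w : O.W s) (π : O.Rep s), O.leviOf π = O.src w → O.tgt w = O.src w → O.detNeg w = false →
    O.tempered π → O.generic π →
    ∀ (hiso : O.Iso (O.wact w π) π) (hreg : O.Regular w π (O.phiOf π)),
      O.Omega π ∘ₗ Mok.RPtildeOp O w π hiso hreg = O.Omega π

/-- **[Mok] Prop 3.5.3 (b) at scope `s`** (`main.tex:L3217–L3220`), VERBATIM: "(b) Let $(\Pi,\mathcal{V})$ be the
unique irreducible $(B,\chi)$-generic subrepresentation of $\mathcal{I}_P(\pi_M)$. Then for $w \in W(\pi_M)$ we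
have: \begin{eqnarray} R_P(w, \widetilde{\pi}_M) \phi = \phi, \,\ \phi \in \mathcal{V}_{\infty}. \end{eqnarray}"
(`𝒱_∞` = `genSub π`, cell DIVERGENCE D-TY-55). [cite: Mok2012, Prop 3.5.3(b) l.3217-3220] -/
def Mok.P353bAt (O : OpData K) (s : LocalClassicalScope) : Prop :=
  ∀ (w : O.W s) (π : O.Rep s), O.leviOf π = O.src w → O.tgt w = O.src w → O.detNeg w = false →
    O.tempered π → O.generic π →
    ∀ (hiso : O.Iso (O.wact w π) π) (hreg : O.Regular w π (O.phiOf π)),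
      ∀ v ∈ O.genSub π, Mok.RPtildeOp O w π hiso hreg v = v

/-- Mok's groups, tempered generic parameters: `F` of characteristic zero, `G = U_{E/F}(N)` or `G_{E/F}(N)`
quasi-split (`main.tex:L3156–L3158`). [cite: Mok2012, §3.5 setting l.3156-3158] -/
abbrev Mok.p353Scope (s : LocalClassicalScope) : Prop :=
  s.field.isCharZero = true ∧ s.form = .quasiSplit ∧ s.type.isMok = true ∧ s.params = .temperedGeneric

/-- **[Mok] Prop 3.5.3 (a)** = node `P353` of the [Mok] DAG, on Mok's groups. STATUS: PUBLISHED as Mok's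
attribution to Shahidi \cite{S,S1,S2} (`L3206`); re-proved as [AGIKMS] Thm 1.8.1 "cf." (both premises carried
by the DAG edge `E_P353`). [cite: Mok2012, Prop 3.5.3(a) l.3206-3213] -/
def Mok.P353 (O : OpData K) : Prop := ∀ s, Mok.p353Scope s → Mok.P353aAt O s

/-- `G = G_{E/F}(N)` (`E/F` quadratic), `F` of characteristic zero, quasi-split: the scopes of [Mok]
Prop 3.5.1 (`L2966–L2972` "Consider first the untwisted case $W_{\psi^N}(M) = W^0_{\psi^N}(G_{E/F}(N),M)$.").
[cite: Mok2012, §3.5 l.2966-2972] -/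
abbrev Mok.a12Scope (s : LocalClassicalScope) : Prop :=
  s.field.isCharZero = true ∧ (∃ N, s.type = ClassicalType.GL N true) ∧ s.form = .quasiSplit

/-- **[Mok] Prop 3.5.1 (node `A12`), READ through [AGIKMS]** (`main.tex:L3021–L3035`, VERBATIM:
"\begin{proposition} \cite{A12} \bigskip \noindent (a) For $w^0 \in W_{\psi^N}(M)$ we have \begin{eqnarray}
R_P(w^0,\widetilde{\pi}_{\psi^M}) \equiv 1. \end{eqnarray} \bigskip \noindent (b) For $w \in
\widetilde{W}_{\psi^N}(M)$ we have \begin{eqnarray} \widetilde{R}_P(w, \widetilde{\pi}_{\psi^M}) =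
\widetilde{\mathcal{I}}_P(\pi_{\psi^M},N). \end{eqnarray} \end{proposition}"): part (a) = [AGIKMS] Thm 3.5.1
("as in \cite[Proposition 3.5.1 (a)]{Mok}", `note30.tex:L5541`), part (b) = [AGIKMS] Thm 1.9.1 ("cf. {\cite[Theorem 2.5.3]{Ar},
\cite[Proposition 3.5.1 (b)]{Mok}}", `L2020`), both on `G_{E/F}(N)` scopes; Mok's own form of (b) is not typed
(cell DIVERGENCE D-TY-60). [cite: Mok2012, Prop 3.5.1 l.3021-3035 (reading via AGIKMS2024 Thms 3.5.1 / 1.9.1)] -/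
def Mok.A12 (O : OpData K) : Prop :=
  ∀ s, Mok.a12Scope s → AGIKMS.UntwistedGLAt O s ∧ AGIKMS.Main2At O s

/-- **Regularity for GENERIC tempered `π_M` on Mok's groups is Shahidi's** ([Mok] `main.tex:L3170`, VERBATIM:
"Thus in our context (i.e. for $G=U_{E/F}(N)$ or $G_{E/F}(N)$) if we are in the case where $\pi_M$ is a generic
representation, then proposition 3.3.1 and 3.3.5 already follows from \cite{S,S1,S2}."; Prop 3.3.1 (b),
`L2026–L2029`: "In particular the operator $R_{P^{\prime}|P}(\pi_{\lambda},\psi_{\lambda})$ is uniatry and hence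
analytic if $\lambda$ is purely imaginary. Hence we can define the operator \[ R_{P^{\prime}|P}(\pi,\psi) :=
R_{P^{\prime}|P}(\pi_0,\psi_0). \]", and `R_P(w,\pi,\psi) = l(w,\pi,\psi) \circ R_{w^{-1}P|P}(\pi,\psi)`
(`L2537`)): for `π` tempered generic on a Levi of `U_{E/F}(N)` or `G_{E/F}(N)`, `R_P(w, π_λ, φ_λ)` is regular at
`λ = 0` — the input that makes `R_P(w, π_M)` of Prop 3.5.3 / Thm 1.8.1 a well-defined operator there, PUBLISHED and
free of Mok's induction.  (For NON-generic `π` and for the non-tempered `π_ψ ∘ θ` of Thm 1.9.1 the sources recalled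
by [AGIKMS] `note30.tex:L1787–L1788` are [Ar, Prop 2.3.1] and [Mok, Prop 3.3.1] themselves, the latter stated under
`L2013` "Assume that the local and global theorems of section 2.5 are valid if $N$ is replaced by any integer $N_-
< N$."; cell GAPS G-TY-6-1.) [cite: Mok2012, l.3170 with Prop 3.3.1(b) l.2026-2029 (attribution of the generic case to Shahidi [S,S1,S2])] -/
def Shahidi.RegularGeneric (O : OpData K) : Prop :=
  ∀ s, Mok.p353Scope s → ∀ (w : O.W s) (π : O.Rep s), O.leviOf π = O.src w → O.tempered π → O.generic π →
    O.Regular w π (O.phiOf π)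

/-- **[Mok] Prop 3.5.3 (a) with the operator's existence discharged**: on Mok's groups, given Shahidi's
regularity, for every `w ∈ W(π_M)` the operator `R_P(w, π̃_M)` EXISTS and fixes `Ω_{χ,ω}(π_M)` — the hypothesis
`Regular` of `Mok.P353aAt` is not an extra assumption there. [folklore] (bookkeeping; proved here) -/
theorem Mok.P353a_exists (O : OpData K) (hS : Shahidi.RegularGeneric O) (h : Mok.P353 O) :
    ∀ s, Mok.p353Scope s → ∀ (w : O.W s) (π : O.Rep s), O.leviOf π = O.src w → O.tgt w = O.src w →
      O.detNeg w = false → O.tempered π → O.generic π → ∀ (hiso : O.Iso (O.wact w π) π),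
        ∃ hreg : O.Regular w π (O.phiOf π), O.Omega π ∘ₗ Mok.RPtildeOp O w π hiso hreg = O.Omega π :=
  fun s hs w π hsrc htgt hdet ht hg hiso =>
    ⟨hS s hs w π hsrc ht hg, h s hs w π hsrc htgt hdet ht hg hiso (hS s hs w π hsrc ht hg)⟩

/-! ## §16.4  Named hypotheses of the proofs (the three squares, Schur steps) -/

/-- **Normalisation of `π̃_M(w)` on `I_P`** (untwisted; `π = π_M` tempered generic): `Ω(π) ∘ I_P(π̃_M(w)) = Ω(wπ)` —
the unfolding, through the Jacquet integral, of [Mok]'s defining condition `main.tex:L3174–L3175` "$\widetilde{\pi}_M$ is uniquely determined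
by the condition \[ \omega \circ \widetilde{\pi}_M = \omega. \]"; its twisted twin is stated by [AGIKMS]
(`note30.tex:L4641–L4643`, see `OpData.NormTw`). [cite: Mok2012, l.3172-3175 (normalisation of the canonical intertwining operator; unfolded on I_P)] -/
def OpData.NormUn (O : OpData K) : Prop :=
  ∀ {s : LocalClassicalScope} (w : O.W s) (π : O.Rep s), O.tempered π → O.generic π →
    ∀ (hiso : O.Iso (O.wact w π) π), O.Omega π ∘ₗ O.IPun w π hiso = O.Omega (O.wact w π)

/-- **The right square** of [AGIKMS] `note30.tex:L4642–L4643`, VERBATIM: "whereas the one for the right square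
follows from $\omega \circ \tl\pi(w \rtimes \theta) = \omega$, which is the definition of the normalization of
$\tl\pi(w \rtimes \theta)$.": for `G = GL_N(E)` and `π` tempered generic, `Ω(π) ∘ I_P(π̃(w ⋊ θ)) = Ω(w(π ∘ θ))`.
[claim: AGIKMS2024, under-review] (proof of Thm 1.9.1, tempered case, l.4642-4643) -/
def OpData.NormTw (O : OpData K) : Prop :=
  ∀ {s : LocalClassicalScope}, isGLScope s → ∀ (w : O.W s) (π : O.Rep s), O.tempered π → O.generic π →
    ∀ (hiso : O.Iso (O.wact w (O.thetaRep π)) π),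
      O.Omega π ∘ₗ O.IPtw w π hiso = O.Omega (O.wact w (O.thetaRep π))

/-- **The left square** (`note30.tex:L4681–L4682`), VERBATIM: "Hence, Lemma \ref{tits} implies that $\Omega(\pi
\circ \theta) \circ \theta^* = \Omega(\pi)$." — for `G = GL_N(E)` and (`L4601`) "an irreducible tempered
representation $\pi$ of $M$" with (`L4606`) "a non-trivial $\ww_M$-Whittaker functional $\omega$ on $\pi$"
(Lemma 3.2.1 = `tits`, `L4648–L4653`: "For $w \in W^G$, we have \[ \theta(\tl{w}) =\tl{\theta(w)}. \]"). [claim: AGIKMS2024, under-review] (proof of Thm 1.9.1, tempered case, l.4601-4682) -/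
def OpData.LeftSq (O : OpData K) : Prop :=
  ∀ {s : LocalClassicalScope}, isGLScope s → ∀ (π : O.Rep s), O.tempered π → O.generic π →
    O.Omega (O.thetaRep π) ∘ₗ O.thetaStar π = O.Omega π

/-! ## §16.5  Kernel facts: the structure of the three normalisation arguments -/

/-- **The three squares give `Ω(π) ∘ R̃_P(θ ∘ w, π̃) = Ω(π)`** ([AGIKMS] `note30.tex:L4628–L4641`, VERBATIM: "So
it suffices to check that the three squares in the diagram […] are all commutative. Here, we note that all these
$\Omega$ are induced by the same linear functional $\omega$. The commutativity of the middle square is nothing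
but Theorem \ref{main1} (2)"). [folklore] (linear algebra; proved here) -/
theorem AGIKMS.omega_rtilde_of_squares (O : OpData K) {s : LocalClassicalScope} (w : O.W s) (π : O.Rep s)
    (ψθ : O.NPar s) (hiso : O.Iso (O.wact w (O.thetaRep π)) π) (hreg : O.Regular w (O.thetaRep π) ψθ)
    (left : O.Omega (O.thetaRep π) ∘ₗ O.thetaStar π = O.Omega π)
    (middle : O.Omega (O.wact w (O.thetaRep π)) ∘ₗ O.R w (O.thetaRep π) ψθ hreg = O.Omega (O.thetaRep π))
    (right : O.Omega π ∘ₗ O.IPtw w π hiso = O.Omega (O.wact w (O.thetaRep π))) :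
    O.Omega π ∘ₗ AGIKMS.RtildeOp O w π ψθ hiso hreg = O.Omega π := by
  unfold AGIKMS.RtildeOp
  rw [← LinearMap.comp_assoc, right, ← LinearMap.comp_assoc, middle, left]

/-- **The middle square IS Thm 1.8.1 (2)** applied to `(θ(P), π ∘ θ, w ∈ W(θ(M), θ(θ(M))))` (`L4641`): the
dependency of Thm 1.9.1 on Thm 1.8.1 (2), with the identifications it uses as explicit hypotheses (`π ∘ θ` is a
representation of `θ(M) = src w`; `tgt w = M = θ(θ(M))`; `w(π ∘ θ) ≅ π = (π ∘ θ) ∘ θ`).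
[folklore] (specialisation; proved here) -/
theorem AGIKMS.middleSquare_of_main1b (O : OpData K) {s : LocalClassicalScope} (h : AGIKMS.Main1bAt O s)
    (w : O.W s) (π : O.Rep s) (hsrc : O.leviOf (O.thetaRep π) = O.src w)
    (htgt : O.tgt w = O.thetaL (O.src w)) (ht : O.tempered (O.thetaRep π)) (hg : O.generic (O.thetaRep π))
    (hiso' : O.Iso (O.wact w (O.thetaRep π)) (O.thetaRep (O.thetaRep π)))
    (hreg : O.Regular w (O.thetaRep π) (O.phiOf (O.thetaRep π))) :
    O.Omega (O.wact w (O.thetaRep π)) ∘ₗ O.R w (O.thetaRep π) (O.phiOf (O.thetaRep π)) hreg =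
      O.Omega (O.thetaRep π) :=
  h w (O.thetaRep π) hsrc htgt ht hg hiso' hreg

/-- **`R̃ = θ_A` from the Whittaker identity** (`L4616–L4619` with `L4609–L4615`, VERBATIM: "$\theta_A =
\theta_W$ is the unique linear isomorphism $\theta_A \colon I_P(\pi) \xrightarrow{\sim} I_P(\pi)$ such that
\begin{align*} \theta_A \circ I_P(\pi)(h) &= I_P(\pi)(\theta(h)) \circ \theta_A, \quad h \in \GL_N(E), \\
\Omega(\pi) \circ \theta_A &= \Omega(\pi). \end{align*}", and `L2016`: "Hence $\tl{R}_P(\theta \circ w,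
\tl{\pi}_\psi)$ is a constant multiple of $\theta_A$."): hypotheses = the Schur step (`hmult`), the normalisation
and bijectivity of `θ_A`, `Ω(π) ≠ 0`. [folklore] (linear algebra; proved here) -/
theorem AGIKMS.rtilde_eq_thetaA_of_whittaker (O : OpData K) {s : LocalClassicalScope} (w : O.W s)
    (π : O.Rep s) (ψθ : O.NPar s) (hiso : O.Iso (O.wact w (O.thetaRep π)) π)
    (hreg : O.Regular w (O.thetaRep π) ψθ)
    (hΩR : O.Omega π ∘ₗ AGIKMS.RtildeOp O w π ψθ hiso hreg = O.Omega π)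
    (hmult : ∃ c : K, AGIKMS.RtildeOp O w π ψθ hiso hreg = c • O.thetaA π)
    (hθ : O.Omega π ∘ₗ O.thetaA π = O.Omega π) (hΩ : O.Omega π ≠ 0)
    (hsurj : Function.Surjective (O.thetaA π)) :
    AGIKMS.RtildeOp O w π ψθ hiso hreg = O.thetaA π := by
  obtain ⟨c, hc⟩ := hmult
  exact eq_of_smul_of_functional (O.Omega π) (O.thetaA π) _ c hc hΩR hθ hΩ hsurj

/-- **[AGIKMS] Thm 1.9.1 in the tempered case at an instance, from Thm 1.8.1 (2)** (`note30.tex:L4601–L4682`):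
given Thm 1.8.1 (2) at the scope, the left and right squares at the instance (`OpData.LeftSq`, `OpData.NormTw`),
the Schur step and the two properties of `θ_A`,
`R̃_P(θ ∘ w, π̃) = θ_A` with `R_{θ(P)}(w, π ∘ θ)` normalised at the `L`-parameter of `π ∘ θ`.
[folklore] (assembly of the tempered-case proof; proved here) -/
theorem AGIKMS.main2_tempered_at (O : OpData K) {s : LocalClassicalScope} (h : AGIKMS.Main1bAt O s)
    (w : O.W s) (π : O.Rep s) (hsrc : O.leviOf (O.thetaRep π) = O.src w)
    (htgt : O.tgt w = O.thetaL (O.src w)) (ht : O.tempered (O.thetaRep π)) (hg : O.generic (O.thetaRep π))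
    (hiso' : O.Iso (O.wact w (O.thetaRep π)) (O.thetaRep (O.thetaRep π)))
    (hiso : O.Iso (O.wact w (O.thetaRep π)) π) (hreg : O.Regular w (O.thetaRep π) (O.phiOf (O.thetaRep π)))
    (left : O.Omega (O.thetaRep π) ∘ₗ O.thetaStar π = O.Omega π)
    (right : O.Omega π ∘ₗ O.IPtw w π hiso = O.Omega (O.wact w (O.thetaRep π)))
    (hmult : ∃ c : K, AGIKMS.RtildeOp O w π (O.phiOf (O.thetaRep π)) hiso hreg = c • O.thetaA π)
    (hθ : O.Omega π ∘ₗ O.thetaA π = O.Omega π) (hΩ : O.Omega π ≠ 0)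
    (hsurj : Function.Surjective (O.thetaA π)) :
    AGIKMS.RtildeOp O w π (O.phiOf (O.thetaRep π)) hiso hreg = O.thetaA π :=
  AGIKMS.rtilde_eq_thetaA_of_whittaker O w π _ hiso hreg
    (AGIKMS.omega_rtilde_of_squares O w π _ hiso hreg left
      (AGIKMS.middleSquare_of_main1b O h w π hsrc htgt ht hg hiso' hreg) right)
    hmult hθ hΩ hsurj

/-- **[Mok] Prop 3.5.3 (a) from [AGIKMS] Thm 1.8.1 (1)** and the normalisation of `π̃_M(w)`: on Mok's (connected)
groups the `O_{2n}` branch is absent and `Ω(π_M) ∘ (π̃_M(w) ∘ R_P(w, π_M)) = Ω(wπ_M) ∘ R_P(w, π_M) = Ω(π_M)`.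
The AGIKMS premise of the DAG edge `E_P353`, made a theorem. [folklore] (proved here) -/
theorem Mok.P353_of_main1 (O : OpData K) (h : AGIKMS.Main1 O) (hN : O.NormUn) : Mok.P353 O := by
  intro s hs w π hsrc htgt hdet ht hg hiso hreg
  have h1 := (h s ⟨hs.1, hs.2.1, hs.2.2.2⟩).1 w π hsrc htgt ht hg hiso hreg
  rw [hdet] at h1
  unfold Mok.RPtildeOp
  rw [← LinearMap.comp_assoc, hN w π ht hg hiso, h1]
  simp

/-- **[Mok] Prop 3.5.3 (b) from (a) at an instance** (`main.tex:L3223`): with the Schur step ("the restriction of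
$R_P(w,\widetilde{\pi}_M)$ to the irreducible subspace $\mathcal{V}$ is a non-zero scalar") and the support
statement ("the Whittaker functional $\Omega_{\chi,\omega}(\pi_M)$ on $\mathcal{H}_{P,\infty}(\pi_M)$ is supported
on $\mathcal{V}_{\infty}$", read: `Ω` does not vanish on `𝒱`) as hypotheses. [folklore] (proved here) -/
theorem Mok.P353b_of_a_at (O : OpData K) {s : LocalClassicalScope} (w : O.W s) (π : O.Rep s)
    (hiso : O.Iso (O.wact w π) π) (hreg : O.Regular w π (O.phiOf π))
    (ha : O.Omega π ∘ₗ Mok.RPtildeOp O w π hiso hreg = O.Omega π)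
    (hschur : ∃ c : K, ∀ v ∈ O.genSub π, Mok.RPtildeOp O w π hiso hreg v = c • v)
    (hsupp : ∃ v ∈ O.genSub π, O.Omega π v ≠ 0) :
    ∀ v ∈ O.genSub π, Mok.RPtildeOp O w π hiso hreg v = v := by
  obtain ⟨c, hc⟩ := hschur
  exact acts_by_one_of_functional (O.Omega π) _ (O.genSub π) c hc ha hsupp

/-- Region bookkeeping: the consumed regions lie inside the supplied ones (§6 `L18.covered`, `L17.covered`), so
[AGIKMS] Thm 1.8.1 gives the Book's 2.5.1 (b) as read, Thm 1.9.1 the Book's 2.5.3 as read, and Mok's scopes lie in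
both. [folklore] (bookkeeping; proved here) -/
theorem Book.T251b_of_main1 (O : OpData K) (h : AGIKMS.Main1 O) : Book.T251b O :=
  fun s hs => h s (L18.covered s hs)

/-- See `Book.T251b_of_main1`. [folklore] (bookkeeping; proved here) -/
theorem Book.T253_of_main2 (O : OpData K) (h : AGIKMS.Main2 O) : Book.T253 O :=
  fun s hs => h s (L17.covered s hs)

/-- See `Book.T251b_of_main1`. [folklore] (bookkeeping; proved here) -/
theorem Mok.A12_of_AGIKMS (O : OpData K) (h2 : AGIKMS.Main2 O) (hu : AGIKMS.UntwistedGL O) : Mok.A12 O :=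
  fun s ⟨h1, ⟨N, hN⟩, h3⟩ => ⟨hu s ⟨h1, ⟨N, true, hN⟩, h3⟩, h2 s ⟨h1, ⟨N, true, hN⟩, h3⟩⟩

end Statements

/-! ## §16.6  Readings of the DAG nodes and the supply edges as theorems -/

section Bridge

variable {K : Type} [Field K]

/-- **Readings of the [Ar] DAG's intertwining nodes** (M1 `Nodes.AGIKMS_181`, `AGIKMS_191`, `A27a`, `A26`) as this
module's operator statements. [cite: Arthur2013, Thms 2.5.1(b), 2.5.3 (reading hypotheses; second-hand locators AGIKMS2024 l.1924, l.2020)] -/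
structure Book.ReadsOps (ν : Nodes) (O : OpData K) : Prop where
  /-- leaf AGIKMS Thm 1.8.1 ↔ `AGIKMS.Main1` -/
  l181 : ν.AGIKMS_181 ↔ AGIKMS.Main1 O
  /-- leaf AGIKMS Thm 1.9.1 ↔ `AGIKMS.Main2` -/
  l191 : ν.AGIKMS_191 ↔ AGIKMS.Main2 O
  /-- [A27]a = [Ar, Thm 2.5.1 (b)] ↔ `Book.T251b` -/
  a27a : ν.A27a ↔ Book.T251b O
  /-- [A26] = [Ar, Thm 2.5.3] ↔ `Book.T253` -/
  a26 : ν.A26 ↔ Book.T253 O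

/-- **Readings of the [Mok] DAG's intertwining nodes** (M10 `Nodes.AGIKMS_181`, `AGIKMS_191`, `A12`, `P353`); the
leaf `AGIKMS_191` of the [Mok] DAG carries Thm 1.9.1 AND Thm 3.5.1 (edge `E_A12`'s docstring).
[cite: Mok2012, Props 3.5.1, 3.5.3(a) (reading hypotheses)] -/
structure Mok.ReadsOps (μ : Mok2015.Nodes) (O : OpData K) : Prop where
  /-- leaf AGIKMS Thm 1.8.1 ↔ `AGIKMS.Main1` -/
  l181 : μ.AGIKMS_181 ↔ AGIKMS.Main1 O
  /-- leaf AGIKMS Thm 1.9.1 (+ Thm 3.5.1) ↔ `AGIKMS.Main2 ∧ AGIKMS.UntwistedGL` -/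
  l191 : μ.AGIKMS_191 ↔ (AGIKMS.Main2 O ∧ AGIKMS.UntwistedGL O)
  /-- Prop 3.5.1 (node `A12`) ↔ `Mok.A12` -/
  a12 : μ.A12 ↔ Mok.A12 O
  /-- Prop 3.5.3 (a) ↔ `Mok.P353` -/
  p353 : μ.P353 ↔ Mok.P353 O

variable {O : OpData K}

/-- **The supply edge `E_A27a` (AGIKMS Thm 1.8.1 ⟹ [Ar, Thm 2.5.1 (b)]) is a THEOREM under the readings.**
[folklore] (proved here) -/
theorem Book.E_A27a_of_reads {ν : Nodes} (h : Book.ReadsOps ν O) : ν.E_A27a :=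
  fun h181 => h.a27a.mpr (Book.T251b_of_main1 O (h.l181.mp h181))

/-- **The supply edge `E_A26` (AGIKMS Thm 1.9.1 ⟹ [Ar, Thm 2.5.3]) is a THEOREM under the readings.**
[folklore] (proved here) -/
theorem Book.E_A26_of_reads {ν : Nodes} (h : Book.ReadsOps ν O) : ν.E_A26 :=
  fun h191 => h.a26.mpr (Book.T253_of_main2 O (h.l191.mp h191))

/-- **The Book's Thm 2.5.1 (b) and Thm 2.5.3 WITH CONTENT rest on exactly the two PREPRINT leaves `AGIKMS_181`,
`AGIKMS_191`** (no other leaf of the kernel DAG enters). [cite: Arthur2013, Thms 2.5.1(b), 2.5.3 (bookkeeping proved here; second-hand locators as above)] -/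
theorem Book.ops_of_leaves {ν : Nodes} (h : Book.ReadsOps ν O) (Q : ν.PreprintLeaves2026) :
    Book.T251b O ∧ Book.T253 O :=
  ⟨h.a27a.mp (Book.E_A27a_of_reads h Q.agikms181), h.a26.mp (Book.E_A26_of_reads h Q.agikms191)⟩

/-- **The supply edge `E_A12` of the [Mok] DAG is a THEOREM under the readings.** [folklore] (proved here) -/
theorem Mok.E_A12_of_reads {μ : Mok2015.Nodes} (h : Mok.ReadsOps μ O) : μ.E_A12 :=
  fun h191 => h.a12.mpr (Mok.A12_of_AGIKMS O (h.l191.mp h191).1 (h.l191.mp h191).2)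

/-- **The supply edge `E_P353` of the [Mok] DAG is a THEOREM under the readings, from its AGIKMS premise alone**,
given the normalisation of `π̃_M(w)` (`OpData.NormUn`); the Shahidi premise is not used on this route.
[folklore] (proved here) -/
theorem Mok.E_P353_of_reads {μ : Mok2015.Nodes} (h : Mok.ReadsOps μ O) (hN : O.NormUn) : μ.E_P353 :=
  fun _ h181 => h.p353.mpr (Mok.P353_of_main1 O (h.l181.mp h181) hN)

/-- The [Ar] node assignment realising the readings on the nose (consistency of `Book.ReadsOps` relative to any
`ν`). [folklore] (bookkeeping) -/
def Book.opsNodes (ν : Nodes) (O : OpData K) : Nodes :=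
  { ν with
    AGIKMS_181 := AGIKMS.Main1 O
    AGIKMS_191 := AGIKMS.Main2 O
    A27a := Book.T251b O
    A26 := Book.T253 O }

/-- `Book.opsNodes` satisfies the readings. [folklore] (bookkeeping; proved here) -/
theorem Book.opsNodes_reads (ν : Nodes) (O : OpData K) : Book.ReadsOps (Book.opsNodes ν O) O :=
  ⟨Iff.rfl, Iff.rfl, Iff.rfl, Iff.rfl⟩

/-- The [Mok] node assignment realising the readings on the nose. [folklore] (bookkeeping) -/
def Mok.opsNodes (μ : Mok2015.Nodes) (O : OpData K) : Mok2015.Nodes :=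
  { μ with
    AGIKMS_181 := AGIKMS.Main1 O
    AGIKMS_191 := (AGIKMS.Main2 O ∧ AGIKMS.UntwistedGL O)
    A12 := Mok.A12 O
    P353 := Mok.P353 O }

/-- `Mok.opsNodes` satisfies the readings. [folklore] (bookkeeping; proved here) -/
theorem Mok.opsNodes_reads (μ : Mok2015.Nodes) (O : OpData K) : Mok.ReadsOps (Mok.opsNodes μ O) O :=
  ⟨Iff.rfl, Iff.rfl, Iff.rfl, Iff.rfl⟩

end Bridge

end Literature.NumberTheory.Automorphic.Arthur2013.Leaves
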